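import Summits.QuantumFields.YangMills.Theorems.AtomicCalibrationRSmearedOSClauses
import Summits.QuantumFields.YangMills.Theorems.AtomicCalibrationRSmearedTranslations
import HarnessLib

/-!
# AtomicCalibrationR (stmt-QuantumFields-28169), B7 `stub_smearedIVData` — the leaf's OS data from the smeared input, MODULO THE FLOORS
# (composition of the three smeared bricks; prover w4 g23, free hands)

`smeared_osData_modulo_floors`: from the data of `MirrorCalibration.SmearedIVInput` for one group `G` — a unit `a(β) > 0`,
`a → 0`, constants `0 ≤ c n ≤ α Cⁿ (n!)^γ`, an index `N`, a threshold `β₈`, and the SMEARED bound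
`‖Σ'ₓ M_n(μ; q, x)·F(a(β)x + centre_q)‖ ≤ c n·‖F‖_{Nn}` for every `β ≥ β₈`, every `μ ∈ oddTorusLimitPoints r β`, `n ≥ 2`, increasing
orientations and off-diagonal `F` — it produces couplings `β_k → ∞`, states `μ_k ∈ oddTorusLimitPoints r β_k`, a one-field family
`S₁` and limits `T` with EVERY clause of the leaf `InfiniteVolumeContinuum.HypercubicOSDataFromInfiniteVolume` except the last two
(non-triviality and non-Gaussianity, which are to be read from the floors `LowerBounds G r a`): the DATA clauses verbatim, E0
`IsNormalized`, hermiticity, E0′ `HasLinearGrowth`, the exact hyperoctahedral `W₄` invariance on `⁰𝒮`, E2 `IsReflectionPositive`, E3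
`IsSymmetric` and translation invariance on `⁰𝒮`.  (`SmearedCompactness.smearedData` + `SmearedOSClauses.smeared_osClauses` /
`hasLinearGrowth_of_smeared_bound` + `SmearedTranslations.translateMulti_invariant_family_of_smeared`.)

So `stub_smearedIVData` = this file + [floors ⟹ NT/NG for the constructed `S₁`] (the torus ↔ infinite-volume junction at the
plaquette centres; open).  HONEST FRAMING: soft analysis on HYPOTHESES; nothing about Bałaban's RG, a mass gap or Clay; no summit
is proved. [folklore]
-/

set_option autoImplicit false

noncomputable section

open scoped BigOperators SchwartzMap
open MeasureTheory Filter Topology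
open Literature.MathematicalPhysics.QuantumFieldTheory hiding ZdEdge
open Literature.MathematicalPhysics.QuantumLattice
open Literature.MathematicalPhysics.AQFT
open Literature.Probability.LatticeModels (box Site)
open Summit.QuantumFields.YangMills.Theorems.InfiniteVolume (stateMomentStr)
open Summit.QuantumFields.YangMills.Cruxes.AtomicCalibrationR.SmearedCompactness (smearedData)
open Summit.QuantumFields.YangMills.Cruxes.AtomicCalibrationR.SmearedOSClauses (smeared_osClauses
  hasLinearGrowth_of_smeared_bound)
open Summit.QuantumFields.YangMills.Cruxes.AtomicCalibrationR.SmearedTranslations (translateMulti_invariant_family_of_smeared)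

namespace Summit.QuantumFields.YangMills.Cruxes.AtomicCalibrationR.SmearedLeafModuloFloors

variable {G : Type} [Group G] [TopologicalSpace G] [IsTopologicalGroup G] [CompactSpace G]
  [MeasurableSpace G] [BorelSpace G]

/-- **The leaf's OS data from the smeared input, modulo the floors.**  See the module docstring. [folklore] -/
theorem smeared_osData_modulo_floors (r : LatticeRep G) (a : ℝ → ℝ) (hapos : ∀ β, 0 < a β) (ha0 : Tendsto a atTop (𝓝 0))
    (c : ℕ → ℝ) (N : ℕ) (β₈ : ℝ) (hc : ∀ n, 0 ≤ c n) {α₀ C₀ γ₀ : ℝ} (hα₀ : 0 ≤ α₀) (hC₀ : 0 ≤ C₀)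
    (hcadm : ∀ n, c n ≤ α₀ * C₀ ^ n * (n.factorial : ℝ) ^ γ₀)
    (hbd : ∀ β : ℝ, β₈ ≤ β → ∀ μ ∈ oddTorusLimitPoints r β, ∀ (n : ℕ) (q : Fin n → Fin 4 × Fin 4), 2 ≤ n →
      (∀ i, (q i).1 < (q i).2) → ∀ F : 𝓢((Fin n → EuclideanSpace ℝ (Fin 4)), ℂ), IsOffDiagonal F →
        ‖∑' x : Fin n → (Fin 4 → ℤ), ((stateMomentStr G r μ n q x : ℝ) : ℂ) *
            F (fun l => a β • siteToE (x l) +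
              (a β / 2) • (EuclideanSpace.single (q l).1 (1 : ℝ) + EuclideanSpace.single (q l).2 (1 : ℝ)))‖ ≤
          c n * schwartzNorm (N * n) F) :
    ∃ (β : ℕ → ℝ) (μ : ℕ → Measure (LGConfig 4 G)) (S₁ : SchwingerFamily (EuclideanSpace ℝ (Fin 4)))
      (T : (n : ℕ) → (Fin n → Fin 4 × Fin 4) → (𝓢((Fin n → EuclideanSpace ℝ (Fin 4)), ℂ) →L[ℂ] ℂ)),
      (Tendsto β atTop atTop ∧ (∀ k, μ k ∈ oddTorusLimitPoints r (β k)) ∧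
        (∀ F : 𝓢((Fin 0 → EuclideanSpace ℝ (Fin 4)), ℂ), S₁ 0 F = F default) ∧
        (∀ F : 𝓢((Fin 1 → EuclideanSpace ℝ (Fin 4)), ℂ), S₁ 1 F = 0) ∧
        (∀ n : ℕ, 2 ≤ n → ∀ F : 𝓢((Fin n → EuclideanSpace ℝ (Fin 4)), ℂ),
          S₁ n F = ∑ q ∈ Fintype.piFinset (fun _ : Fin n => Finset.univ.filter fun p : Fin 4 × Fin 4 => p.1 < p.2),
            T n q F) ∧
        (∀ n : ℕ, 2 ≤ n → ∀ q : Fin n → Fin 4 × Fin 4, (∀ i, (q i).1 < (q i).2) →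
          ∀ F : 𝓢((Fin n → EuclideanSpace ℝ (Fin 4)), ℂ), IsOffDiagonal F →
            Tendsto (fun k => ∑' x : Fin n → (Fin 4 → ℤ), ((stateMomentStr G r (μ k) n q x : ℝ) : ℂ) *
              F (fun l => a (β k) • siteToE (x l) +
                (a (β k) / 2) • (EuclideanSpace.single (q l).1 (1 : ℝ) + EuclideanSpace.single (q l).2 (1 : ℝ))))
              atTop (𝓝 (T n q F)))) ∧
      (∀ k, β₈ ≤ β k) ∧ (∀ k, IsProbabilityMeasure (μ k)) ∧
      S₁.toLabelled.IsNormalized ∧ S₁.toLabelled.IsHermitian ∧ S₁.toLabelled.HasLinearGrowth ∧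
      (∀ R : EuclideanSpace ℝ (Fin 4) ≃ₗᵢ[ℝ] EuclideanSpace ℝ (Fin 4),
        (∀ i : Fin 4, ∃ j : Fin 4, R (EuclideanSpace.single i (1 : ℝ)) = EuclideanSpace.single j (1 : ℝ) ∨
          R (EuclideanSpace.single i (1 : ℝ)) = -EuclideanSpace.single j (1 : ℝ)) →
        ∀ (n : ℕ) (F : 𝓢((Fin n → EuclideanSpace ℝ (Fin 4)), ℂ)), IsOffDiagonal F → S₁ n (linActMulti R F) = S₁ n F) ∧
      S₁.toLabelled.IsReflectionPositive ∧ S₁.toLabelled.IsSymmetric ∧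
      (∀ (n : ℕ) (t : EuclideanSpace ℝ (Fin 4)) (F : 𝓢((Fin n → EuclideanSpace ℝ (Fin 4)), ℂ)), IsOffDiagonal F →
        S₁ n (translateMulti t F) = S₁ n F) := by
  obtain ⟨β, μ, S₁, T, hdata, hβ8, hprob, ha24, hTb, hS₁bd⟩ := smearedData r a hapos ha0 c N β₈ hc hbd
  obtain ⟨hβ, hμ, h0, h1, hS, hT⟩ := hdata
  have haβ0 : Tendsto (fun k => a (β k)) atTop (𝓝 0) := ha0.comp hβ
  obtain ⟨hN, hRP, hH, hW4, hSym⟩ := smeared_osClauses r a hapos β hβ haβ0 μ S₁ T hμ h0 h1 hS hT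
  have hLG := hasLinearGrowth_of_smeared_bound S₁ c N hS₁bd hα₀ hC₀ hcadm
  have hTr := translateMulti_invariant_family_of_smeared r β (fun k => hapos (β k)) ha24 haβ0 μ hμ S₁ T h0 h1 hS c N
    (fun k n q hn hq F hF => hbd (β k) (hβ8 k) (μ k) (hμ k) n q hn hq F hF) hT
  exact ⟨β, μ, S₁, T, ⟨hβ, hμ, h0, h1, hS, hT⟩, hβ8, hprob, hN, hH, hLG, hW4, hRP, hSym, hTr⟩

end Summit.QuantumFields.YangMills.Cruxes.AtomicCalibrationR.SmearedLeafModuloFloors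

end
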